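import Summits.HodgeConjecture.CorCM.KunnethDegreeOne
import Literature.NumberTheory.Automorphic.PicardCMUniverse
import Literature.AlgebraicGeometry.HodgeTheory.BettiUniverseAxioms
import Literature.AlgebraicGeometry.HodgeTheory.HodgeRiemannPolarizabilityProofs
import Literature.AlgebraicTopology.SingularHomology.CohomologyOfPoint
import HarnessLib

/-!
# COR-CM model layer (model-2): the top-degree trace is injective and `H⁰ = ℚ · 1` on the
# Picard–CM model universe (`Fact_trTopCM`, `Fact_unitH0` (iii))

Cell `pub-hodgecm2` (COR-CM), seat `model-2`; inputs of row Fg6 of `BINDER-OWNERS.md`.  The stage-1 package derives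
F6 `Universe.Fact_weightDual` from `ModelAxioms` + N1 + F5 + the class-M facts `Fact_dimProd`, `Fact_trTopCM`,
`Fact_unitH0` (`HodgeCM/StubTree/WeightDualUnit.lean`, `Universe.weightDual_of_unitH0`).  This file proves the
variety-level content of the last two for the model of record (tree objects `PicardCM.Var`, `BettiUniverse.tr`,
`bettiOne`):

* `tr_top_injective` / `var_tr_top_injective`: `BettiUniverse.tr hX (2n)` is injective — `H^{2n}(X(ℂ); ℚ)` is a line
  (`finrank_rat_top`) and the tree's light trace is the coordinate functional of that line;
* `eq_smul_one_of_pathConnectedSpace_rat` / `var_coh_zero_eq_smul_one`: `H⁰(X(ℂ); ℚ) = ℚ · 1` for the (path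
  connected) varieties of the universe.

The junction theorems `universeOf_fact_trTopCM`, `universeOf_fact_unitH0`, `universeOf_fact_weightDual` land with the
ports of the package files that DEFINE those facts (`StubTree/Qw8Monomial`, `StubTree/Qw8GysinDescentH0`,
`StubTree/WeightDualUnit`).
-/

noncomputable section

open CategoryTheory
open Literature.AlgebraicGeometry.Motives (bettiCohomology bettiOne IsSmoothProjective SchemeOver ComplexPoints)
open Literature.AlgebraicTopology.SingularHomology
open Literature.AlgebraicGeometry.ShimuraVarieties
open Literature.NumberTheory.Automorphic
open Literature.NumberTheory.Automorphic.PicardCM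
open Literature.AlgebraicGeometry.HodgeTheory

namespace Summit.HodgeConjecture.CorCM.Model

/-! ### Scheme / space level -/

/-- **The top-degree trace is injective**: `H^{2n}(X(ℂ); ℚ)` is a line for `X` smooth projective of dimension `n`
(`finrank_rat_top`), and there `BettiUniverse.tr` is the coordinate functional along a basis vector of that line.
[cite: VoisinHodgeI2002, §5.3.2 Thm. 5.30] [cite: HatcherAT2002, §3.3 Thm. 3.26] -/
theorem tr_top_injective {n : ℕ} {X : SchemeOver ℂ} (hX : IsSmoothProjective n X) :
    Function.Injective (BettiUniverse.tr hX (2 * n)) := by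
  have h1 : Module.finrank ℚ (bettiCohomology X (2 * n)) = 1 := finrank_rat_top hX
  rw [BettiUniverse.tr_of_finrank_eq_one hX h1]
  intro x y hxy
  refine (BettiUniverse.lineBasis hX (2 * n) h1).ext_elem fun i ↦ ?_
  obtain rfl : i = 0 := Subsingleton.elim _ _
  simpa only [Module.Basis.coord_apply] using hxy

/-- `H⁰(Y; ℚ) = ℚ · 1` for a path-connected space: every degree-`0` class is its value at a point times the unit
(`singularCohomologyZeroEquiv`). [cite: HatcherAT2002, §3.1 p. 199] -/
theorem eq_smul_one_of_pathConnectedSpace_rat {Y : Type} [TopologicalSpace Y] [PathConnectedSpace Y]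
    (z : singularCohomology ℚ ℚ Y 0) :
    z = (singularCohomologyZeroEquiv ℚ ℚ Y z) • singularCohomology.one ℚ Y := by
  apply (singularCohomologyZeroEquiv ℚ ℚ Y).injective
  rw [map_smul, singularCohomology.one, singularCohomologyZeroEquiv_π,
    singularCochainComplex.cocyclesZeroEquiv_apply, singularCochainComplex.iCocycles_mk,
    cochainOne_apply, smul_eq_mul, mul_one]

/-! ### The model of record: every `PicardCM.Var` -/

/-- **`Fact_trTopCM` at variety level**: the top-degree trace of every variety of the Picard–CM universe is
injective. [cite: VoisinHodgeI2002, §5.3.2 Thm. 5.30] -/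
theorem var_tr_top_injective (hU : BallQuotientUniformisedDatum) (h₃ : CMAbelianVarietyRealised) (v : Var) :
    Function.Injective (BettiUniverse.tr (Var.isSmoothProjective hU h₃ v) (2 * v.dim)) :=
  tr_top_injective (Var.isSmoothProjective hU h₃ v)

/-- **`Fact_unitH0` (iii) at variety level**: `H⁰(X(ℂ); ℚ) = ℚ · 1_X` for every variety of the Picard–CM universe
(`X(ℂ)` is path connected: `pathConnectedSpace_complexPoints`). [cite: HatcherAT2002, §3.1 p. 199] -/
theorem var_coh_zero_eq_smul_one (hU : BallQuotientUniformisedDatum) (h₃ : CMAbelianVarietyRealised) (v : Var)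
    (e : Var.Coh hU h₃ v 0) : ∃ r : ℚ, e = r • bettiOne (Var.scheme hU h₃ v) := by
  haveI := pathConnectedSpace_complexPoints (Var.isSmoothProjective hU h₃ v)
  exact ⟨_, eq_smul_one_of_pathConnectedSpace_rat e⟩

end Summit.HodgeConjecture.CorCM.Model
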